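/-
Copyright: statement-level skeleton of a published paper (lit-balaban cell, Phase-2 proof seat p39 gen 7). No proof claims
beyond what the kernel checks below.
-/
import Literature.MathematicalPhysics.QuantumFieldTheory.Balaban1983to89.B3ZeroTorusKernelProfiles
import Literature.MathematicalPhysics.QuantumFieldTheory.Balaban1983to89.B3KernelConvolutionTorusSharp
import Literature.MathematicalPhysics.QuantumFieldTheory.Balaban1983to89.B3KernelConvolutionTorusOneTwo

/-!
# B3 — T. Bałaban, *(Higgs)₂,₃ quantum fields in a finite volume. III. Renormalization*, CMP **88** (1983) 411–445
[Balaban1983Higgs3], p. 441 [PDF 31] with (3.16) p. 437 [PDF 27]: the DIFFERENCE KERNEL `M = G^ξ_k(0) − C^ξ_T =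
ξ^d·G^ξ_k(0)(1 − m²_{j″} − a_{j″}P_{j″})C^ξ_T` of the replacement *"Next we replace the propagator G_{j₀}(0) by C^ξ, ξ = L^{−j₀},
using the same equation as in (3.16). If at least one propagator G_{j₀}(0) is replaced by G_{j₀}(0)(1 − m²_{j₀} − a_{j₀}P_{j₀})C^ξ,
then we get a convergent expression."* — ITS DIFFERENTIATED KERNELS ARE ONE DEGREE BETTER THAN A PROPAGATOR'S, at the zero-field
torus instance, ALL SITES, `d = 3`: `|M| ≤ C`, `|∂^ξ_μM|, |M∂^{ξ*}_μ| ≤ C(ξ·max(1,|y−y′|))^{−1}e^{−δξ|y−y′|}` and — the point —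
the MIXED second difference `|(∂^ξ_{μ′}M∂^{ξ*}_μ)(x,x′)| ≤ C(ξ·max(1,|x−x′|))^{−1}e^{−δξ|x−x′|}` (a propagator has `(ξ|x−x′|)^{−3}`
there), uniformly in the volume — the fact that makes the cross terms of the vector self-energy (3.26) with one `M`
*"convergent"* (file 1 of 2; the Fubini form and the `∃ δ C` package are in `B3MxiFubiniBound`)

statement-level skeleton of published theorems with citation tags; proofs where landed; nothing here is a claim about
the Yang–Mills mass gap

PDF held: `paper:balaban1983-higgs-2-3-quantum-fields-finite-volume` (journal page = PDF page + 410); pp. 437, 441 read on the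
×2 renders `run/shared/lean/pub/pub-balaban/b2b-balaban-ref1/pages/1983-cmp88-higgs23-III/1983-cmp88-higgs23-III-p027-x2.png`,
`…-p031-x2.png`.  Row **B3.Eq3.25-3.32** of `HOME/lit-balaban-r15/ROWS-B3.md` (fold owner r15).  Mechanism (the published
one, *"the same equation as in (3.16)"*): the resolvent identity `M = ξ^dG^ξ_k(0)·D·C^ξ_T`, `D = (1 − (L^kε)²m²)·1 − a_kP_k`
(`B3Eq316ResolventZeroTorus.resolvent316_zeroTorus`), puts one difference on each outer factor,
`∂_{μ′}M∂^*_μ = ξ^d(∂_{μ′}G)·D·(C∂^*_μ)` (`d2Kernel_Mxi`); two kernels of the derivative shape `|·|^{−2}e^{−·}` convolve to ONE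
of the propagator shape `|·|^{−1}e^{−·}` (this seat's `B3KernelConvolutionTorusSharp.conv22_le`, the lattice Riesz composition),
`|·|^{−2} ⋆ |·|^{−1} ≤ O(1)|·|^{−1}` (`B3KernelConvolutionTorusOneTwo.conv21_le`), and `D` preserves these shapes
(`B3ZeroTorusKernelProfiles.abs_Dmid_smear_one_le/two_le`).  Inputs BY NAME: gen 6 `Mxi`, `Dmid`, `Dmid_apply`, `Pk_apply`,
`resolvent316_zeroTorus`, `d1Kernel_eq_deriv_mul`, `CxiT_mul_deriv_transpose_apply`, `B3Eq323CrossTermsZeroTorus.d1Kernel_Mxi`,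
`abs_Mxi_le`, `abs_CxiT_profile`, `B3Bound316ZeroTorus.abs_d1Kernel_CxiT_profile`; gen 7 `G0xi_all_bounds`, `G0xi_symm`,
`dAdjKernel_eq_d1Kernel_of_symm`; p20's `B3Ineq210MixedTorus.mixedT_eq_d2Kernel`.
* §1 `Mxi_symm`, `dAdjKernel_Mxi_eq` (`(M∂^{ξ*}_μ)(y,x′) = (∂^ξ_μM)(x′,y)`), `Pk_symm`, `Dmid_symm`.
* §2 **`d2Kernel_Mxi`**: `(∂^ξ_{μ′}M∂^{ξ*}_μ)(x,x′) = ξ^dΣ_{z′}(Σ_z(∂^ξ_{μ′}G^ξ_k(0))(x,z)D(z,z′))(∂^ξ_μC^ξ_T)(x′,z′)` for ALL `μ′, μ`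
  (gen 6 `dKernel_Mxi` is `μ′ = μ`).
* §3 `abs_d1G_Dmid_le` (`|Σ_z(∂G)(y,z)D(z,z′)| ≤ S·C_G·P₂(y,z′)`), **`abs_d1Kernel_Mxi_le`** (`P₁`), **`abs_d2Kernel_Mxi_le`** (`P₁`, sharp),
  with explicit constants from a derivative bound `C_G·P₂` of `G^ξ_k(0)` with rate `δ`.  The Fubini form and the hypothesis-free
  package `∃ δ C` are in the sequel `B3MxiFubiniBound`.
HONEST SCOPE: the model instance `A = B̃ = 0`, `U ≡ 1`, `Ω` = the whole torus, `d = 3`; `P_p(y,y′) = (ξ·max(1,|y−y′|_∞))^{−p}e^{−δξ|y−y′|_∞}`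
in the sup torus distance; constants explicit in §3, existential (functions of `L, a, m²`) in the sequel.  Mathlib + the cited tree files
only; theorems only, no definitions, no named facts; standard axioms.  Unit `lit-balaban-p39-g7` (Phase-2 proof seat p39, gen 7),
HOME `run/shared/lean/pub/lit-balaban/`, 2026-08-21.
-/

open scoped BigOperators

namespace Literature.MathematicalPhysics.QuantumFieldTheory.Balaban1983to89.B3MxiDifferenceProfiles

open Matrix Finset B1RG242Torus B3GkZeroTorusRescaled B3Eq316ResolventZeroTorus B3KernelConvolutionTorus
open B3KernelConvolutionTorusSup B3Bound316ZeroTorus B3Eq323CrossTermsZeroTorus B3KernelBlockSmearing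
open LatticeFieldCalculus B3Sect3ScalarSelfEnergy B3TorusRadialSums B3Bound316 B3CxiTorusBound
open B3ZeroTorusKernelProfiles B3KernelConvolutionTorusSharp B3KernelConvolutionTorusOneTwo
open B3Ineq210MixedTorus (mixedT mixedT_eq_d2Kernel)
open B3Sect3VectorSelfEnergy (dAdjKernel d2Kernel)

noncomputable section

variable {P : Params}

/-! ## §1 Symmetries -/

section Symm

/-- **`M` is a symmetric kernel**: `M(y,y′) = M(y′,y)` (`G^ξ_k(0)` and `C^ξ_T` are). [cite: Balaban1983Higgs3, (3.16) p.437] -/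
theorem Mxi_symm {a msq : ℝ} (ha : 0 < a) (hm : 0 ≤ msq) (hd : 2 ≤ P.d) {k : ℕ} (hk : 1 ≤ k) (hkm : k ≤ P.m + P.K)
    (y y' : Site P 0) : Mxi P a msq k y y' = Mxi P a msq k y' y := by
  show G0xi P a msq k y y' - CxiT (P.eta k) y y' = G0xi P a msq k y' y - CxiT (P.eta k) y' y
  rw [G0xi_symm ha hm hd hk hkm y y', CxiT_symm (P.eta k) y y']

/-- **`(M∂^{ξ*}_μ)(y,x′) = (∂^ξ_μM)(x′,y)`**: the column difference of the symmetric `M` is its row difference at swapped arguments.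
[cite: Balaban1983Higgs3, (3.16) p.437, (3.26) p.441] -/
theorem dAdjKernel_Mxi_eq {a msq : ℝ} (ha : 0 < a) (hm : 0 ≤ msq) (hd : 2 ≤ P.d) {k : ℕ} (hk : 1 ≤ k) (hkm : k ≤ P.m + P.K)
    (c : ℝ) (μ : Fin P.d) (y x' : Site P 0) :
    dAdjKernel c μ (Mxi P a msq k) y x' = d1Kernel c μ (Mxi P a msq k) x' y :=
  dAdjKernel_eq_d1Kernel_of_symm c μ _ (fun z z' => Mxi_symm ha hm hd hk hkm z z') y x'

/-- `P_k = Q_k^*Q_k` is symmetric: `P_k(z,z′) = P_k(z′,z)`. [cite: Balaban1982Higgs1, (2.20) p.610] -/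
theorem Pk_symm {k : ℕ} (hk : k ≤ P.m + P.K) (z z' : Site P 0) : (Qks P k * Qk P k) z z' = (Qks P k * Qk P k) z' z := by
  rw [Pk_apply hk, Pk_apply hk]
  by_cases h : Site.proj k k z' = Site.proj k k z
  · rw [if_pos h, if_pos h.symm]
  · rw [if_neg h, if_neg fun h' => h h'.symm]

/-- The middle operator `D = (1 − (L^kε)²m²)·1 − a_kP_k` of (3.16) is symmetric. [cite: Balaban1983Higgs3, (3.16) p.437] -/
theorem Dmid_symm (a msq : ℝ) {k : ℕ} (hk : k ≤ P.m + P.K) (z z' : Site P 0) :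
    Dmid P a msq k z z' = Dmid P a msq k z' z := by
  rw [Dmid_apply, Dmid_apply, Pk_symm hk z z']
  by_cases h : z = z'
  · rw [if_pos h, if_pos h.symm]
  · rw [if_neg h, if_neg fun h' => h h'.symm]

end Symm

/-! ## §2 The mixed second difference of `M` for all `μ′, μ` -/

/-- **`(∂^ξ_{μ′}M∂^{ξ*}_μ)(x,x′) = ξ^d·Σ_{z′}(Σ_z(∂^ξ_{μ′}G^ξ_k(0))(x,z)·D(z,z′))·(∂^ξ_μC^ξ_T)(x′,z′)`** for ALL directions `μ′, μ`
(`D = (1 − (L^kε)²m²)·1 − a_kP_k`): the differences of the (3.26) kernel `(∂_{μ′}G∂^*_μ)` applied to `M = ξ^dG(0)DC` go onto the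
outer factors, `∂_{μ′}·(ξ^dG(0)DC)·∂_μᵀ = ξ^d(∂_{μ′}G(0))·D·(C∂_μᵀ)`, and `(C^ξ_T∂_μᵀ)(z′,x′) = (∂_μC^ξ_T)(x′,z′)` by symmetry
(gen 6 `dKernel_Mxi` is the case `μ′ = μ`). [cite: Balaban1983Higgs3, (3.16) p.437, (3.26) p.441] -/
theorem d2Kernel_Mxi {a msq : ℝ} (ha : 0 < a) (hm : 0 ≤ msq) {k : ℕ} (hk : 1 ≤ k) (μ' μ : Fin P.d) (x x' : Site P 0) :
    d2Kernel (P.eta k)⁻¹ μ' μ (Mxi P a msq k) x x' = P.eta k ^ P.d *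
      ∑ z' : Site P 0, (∑ z : Site P 0, d1Kernel (P.eta k)⁻¹ μ' (G0xi P a msq k) x z * Dmid P a msq k z z') *
          d1Kernel (P.eta k)⁻¹ μ (CxiT (P.eta k)) x' z' := by
  have hof : (Mxi P a msq k : Matrix (Site P 0) (Site P 0) ℝ) = Matrix.of (Mxi P a msq k) := rfl
  rw [show d2Kernel (P.eta k)⁻¹ μ' μ (Mxi P a msq k) x x' = mixedT P (P.eta k) μ' μ (Mxi P a msq k) x x' from
      (mixedT_eq_d2Kernel (P.eta k) μ' μ _ x x').symm, mixedT, hof, resolvent316_zeroTorus ha hm hk,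
    Matrix.mul_smul, Matrix.smul_mul, Matrix.smul_apply, smul_eq_mul]
  congr 1
  rw [show deriv P 0 (P.eta k) μ' * (Matrix.of (G0xi P a msq k) * Dmid P a msq k *
      Matrix.of (CxiT (P := P) (j := 0) (P.eta k))) * (deriv P 0 (P.eta k) μ)ᵀ =
      (deriv P 0 (P.eta k) μ' * Matrix.of (G0xi P a msq k)) * Dmid P a msq k *
      (Matrix.of (CxiT (P := P) (j := 0) (P.eta k)) * (deriv P 0 (P.eta k) μ)ᵀ) by simp only [Matrix.mul_assoc]]
  rw [Matrix.mul_apply]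
  refine Finset.sum_congr rfl fun z' _ => ?_
  rw [CxiT_mul_deriv_transpose_apply, Matrix.mul_apply]
  congr 1
  refine Finset.sum_congr rfl fun z _ => ?_
  rw [d1Kernel_eq_deriv_mul]

/-! ## §3 The kernels of `M` from a derivative bound of `G^ξ_k(0)` -/

section Bounds

variable {a msq : ℝ} {k : ℕ} {δ C_G : ℝ}

/-- **`D` on the derivative kernel of `G^ξ_k(0)`**: if `|(∂^ξ_μG^ξ_k(0))(y,z)| ≤ C_G(ξ·max(1,|y−z|))^{−2}e^{−δξ|y−z|}` at all sites, then
`|Σ_z(∂^ξ_μG^ξ_k(0))(y,z)D(z,z′)| ≤ ((1 + m²) + a·S₂(δ))·C_G·(ξ·max(1,|y−z′|))^{−2}e^{−δξ|y−z′|}`,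
`S₂(δ) = 16e^{4δ}(1 + radialConst 3 δ 1 0) + 4e^{2δ}` (`D` symmetric; `abs_Dmid_smear_two_le`). [cite: Balaban1983Higgs3, (3.16) p.437] -/
theorem abs_d1G_Dmid_le (hPd : P.d = 3) (ha : 0 < a) (hmsq : 0 ≤ msq) (hk1 : 1 ≤ k) (hkK : k ≤ P.K) (hδ : 0 < δ)
    (hCG : 0 ≤ C_G)
    (hG2 : ∀ (μ : Fin P.d) (y z : Site P 0), |d1Kernel (P.eta k)⁻¹ μ (G0xi P a msq k) y z| ≤
      C_G * (((P.eta k * max (1 : ℝ) (supDist y z : ℝ)) ^ 2)⁻¹ * Real.exp (-(δ * (P.eta k * (supDist y z : ℝ))))))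
    (μ : Fin P.d) (y z' : Site P 0) :
    |∑ z : Site P 0, d1Kernel (P.eta k)⁻¹ μ (G0xi P a msq k) y z * Dmid P a msq k z z'| ≤
      ((1 + msq) + a * (16 * Real.exp (4 * δ) * 1 * (1 + radialConst 3 δ 1 0) + 4 * Real.exp (2 * δ) * 1)) * C_G *
        (((P.eta k * max (1 : ℝ) (supDist y z' : ℝ)) ^ 2)⁻¹ * Real.exp (-(δ * (P.eta k * (supDist y z' : ℝ))))) := by
  have hkm : k ≤ P.m + P.K := hkK.trans (Nat.le_add_left _ _)
  have hsw : ∑ z : Site P 0, d1Kernel (P.eta k)⁻¹ μ (G0xi P a msq k) y z * Dmid P a msq k z z' =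
      ∑ z : Site P 0, Dmid P a msq k z' z *
        (fun z w : Site P 0 => d1Kernel (P.eta k)⁻¹ μ (G0xi P a msq k) w z) z y := by
    refine Finset.sum_congr rfl fun z _ => ?_
    rw [Dmid_symm a msq hkm z z', mul_comm]
  rw [hsw, supDist_comm y z']
  exact abs_Dmid_smear_two_le ha hmsq hPd hk1 hkK hδ hCG
    (fun z w : Site P 0 => d1Kernel (P.eta k)⁻¹ μ (G0xi P a msq k) w z)
    (fun z w => by
      show |d1Kernel (P.eta k)⁻¹ μ (G0xi P a msq k) w z| ≤ _
      rw [supDist_comm z w]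
      exact hG2 μ w z) z' y

/-- **The row difference of `M` has the PROPAGATOR profile**: `|(∂^ξ_μM)(y,y′)| ≤ K₁·(ξ·max(1,|y−y′|))^{−1}e^{−γξ|y−y′|}`,
`γ = ½min(δ,½)`, `K₁ = (torusConst + 472501)·(S₂(δ)C_G)·(2(1 + R_{δ/2}) + 8(1 + R_{1/2}) + 2(1 + R_δ))` (`R_c = radialConst 3 c 1 0`):
`∂M = ξ^d(∂G)·D·C` (`d1Kernel_Mxi`), `|(∂G)D| ≤ S₂C_G·P₂`, `|C^ξ_T| ≤ (torusConst + 472501)·P₁`, and `P₂ ⋆ P₁ ≤ O(1)P₁` (`conv21_le`).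
[cite: Balaban1983Higgs3, (3.16) p.437] -/
theorem abs_d1Kernel_Mxi_le (hPd : P.d = 3) (ha : 0 < a) (hmsq : 0 ≤ msq) (hk1 : 1 ≤ k) (hkK : k ≤ P.K) (hδ : 0 < δ)
    (hCG : 0 ≤ C_G)
    (hG2 : ∀ (μ : Fin P.d) (y z : Site P 0), |d1Kernel (P.eta k)⁻¹ μ (G0xi P a msq k) y z| ≤
      C_G * (((P.eta k * max (1 : ℝ) (supDist y z : ℝ)) ^ 2)⁻¹ * Real.exp (-(δ * (P.eta k * (supDist y z : ℝ))))))
    (μ : Fin P.d) (y y' : Site P 0) :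
    |d1Kernel (P.eta k)⁻¹ μ (Mxi P a msq k) y y'| ≤
      (torusConst + 472501) *
          (((1 + msq) + a * (16 * Real.exp (4 * δ) * 1 * (1 + radialConst 3 δ 1 0) + 4 * Real.exp (2 * δ) * 1)) * C_G) *
          (2 * (1 + radialConst 3 (δ / 2) 1 0) + 8 * (1 + radialConst 3 (1 / 2) 1 0) + 2 * (1 + radialConst 3 δ 1 0)) *
        ((P.eta k * max (1 : ℝ) (supDist y y' : ℝ))⁻¹ * Real.exp (-(min δ (1 / 2) / 2 * (P.eta k * (supDist y y' : ℝ))))) := by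
  have hkm : k ≤ P.m + P.K := hkK.trans (Nat.le_add_left _ _)
  have hη : 0 < P.eta k := eta_pos P k
  have hη1 : P.eta k ≤ 1 := eta_le_one P k
  have hηd : 0 ≤ P.eta k ^ P.d := (pow_pos hη _).le
  have hN : 1 ≤ P.eta k * (P.sitesPerDir 0 : ℝ) := one_le_eta_mul_sitesPerDir P hkm
  have hT := torusConst_nonneg
  have hS : 0 ≤ ((1 + msq) + a * (16 * Real.exp (4 * δ) * 1 * (1 + radialConst 3 δ 1 0) + 4 * Real.exp (2 * δ) * 1)) * C_G := by
    have := radialConst_nonneg 3 hδ zero_le_one 0; positivity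
  have hγ0 : 0 ≤ min δ (1 / 2) / 2 := by positivity
  have hγδ : 2 * (min δ (1 / 2) / 2) ≤ δ := by linarith [min_le_left δ (1 / 2)]
  have hγh : 2 * (min δ (1 / 2) / 2) ≤ 1 / 2 := by linarith [min_le_right δ (1 / 2)]
  have hconv := conv21_le hPd hη hη1 hδ (by norm_num : (0 : ℝ) < 1 / 2) hγ0 hγδ hγh hS
    (by linarith : (0 : ℝ) ≤ torusConst + 472501)
    (fun y z' : Site P 0 => ∑ z : Site P 0, d1Kernel (P.eta k)⁻¹ μ (G0xi P a msq k) y z * Dmid P a msq k z z')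
    (CxiT (P.eta k)) (fun y z' => abs_d1G_Dmid_le hPd ha hmsq hk1 hkK hδ hCG hG2 μ y z')
    (fun z' y' => abs_CxiT_profile hPd hη hη1 hN z' y') y y'
  rw [d1Kernel_Mxi ha hmsq hk1, abs_mul, abs_of_nonneg hηd]
  calc P.eta k ^ P.d * |∑ z' : Site P 0, (∑ z : Site P 0, d1Kernel (P.eta k)⁻¹ μ (G0xi P a msq k) y z *
          Dmid P a msq k z z') * CxiT (P.eta k) z' y'|
      ≤ P.eta k ^ P.d * ∑ z' : Site P 0, |(∑ z : Site P 0, d1Kernel (P.eta k)⁻¹ μ (G0xi P a msq k) y z *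
          Dmid P a msq k z z') * CxiT (P.eta k) z' y'| :=
        mul_le_mul_of_nonneg_left (Finset.abs_sum_le_sum_abs _ _) hηd
    _ = ∑ z' : Site P 0, P.eta k ^ P.d * (|∑ z : Site P 0, d1Kernel (P.eta k)⁻¹ μ (G0xi P a msq k) y z *
          Dmid P a msq k z z'| * |CxiT (P.eta k) z' y'|) := by
        rw [Finset.mul_sum]
        exact Finset.sum_congr rfl fun z' _ => by rw [abs_mul]
    _ ≤ _ := hconv
    _ = _ := by ring

/-- **THE MIXED SECOND DIFFERENCE OF `M` HAS THE PROPAGATOR PROFILE** (sharp): `|(∂^ξ_{μ′}M∂^{ξ*}_μ)(x,x′)| ≤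
K₂·(ξ·max(1,|x−x′|))^{−1}e^{−γξ|x−x′|}`, `γ = ½min(δ,½)`, `K₂ = 6205·(S₂(δ)C_G)·(3037500 + torusConst + 472501)` — from `d2Kernel_Mxi`,
`|(∂G)D| ≤ S₂C_G·P₂`, `|∂C^ξ_T| ≤ (3037500 + torusConst + 472501)·P₂` and the SHARP composition `P₂ ⋆ P₂ ≤ 6205·P₁` (`conv22_le`).
This is the estimate that makes the `Π_{μμ′}` cross terms `C^ξ·(∂_{μ′}M∂^*_μ)` of (3.26) summable. [cite: Balaban1983Higgs3, (3.16) p.437, (3.26) p.441] -/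
theorem abs_d2Kernel_Mxi_le (hPd : P.d = 3) (ha : 0 < a) (hmsq : 0 ≤ msq) (hk1 : 1 ≤ k) (hkK : k ≤ P.K) (hδ : 0 < δ)
    (hCG : 0 ≤ C_G)
    (hG2 : ∀ (μ : Fin P.d) (y z : Site P 0), |d1Kernel (P.eta k)⁻¹ μ (G0xi P a msq k) y z| ≤
      C_G * (((P.eta k * max (1 : ℝ) (supDist y z : ℝ)) ^ 2)⁻¹ * Real.exp (-(δ * (P.eta k * (supDist y z : ℝ))))))
    (μ' μ : Fin P.d) (x x' : Site P 0) :
    |d2Kernel (P.eta k)⁻¹ μ' μ (Mxi P a msq k) x x'| ≤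
      6205 * (((1 + msq) + a * (16 * Real.exp (4 * δ) * 1 * (1 + radialConst 3 δ 1 0) + 4 * Real.exp (2 * δ) * 1)) * C_G) *
          (3037500 + torusConst + 472501) *
        ((P.eta k * max (1 : ℝ) (supDist x x' : ℝ))⁻¹ * Real.exp (-(min δ (1 / 2) / 2 * (P.eta k * (supDist x x' : ℝ))))) := by
  have hkm : k ≤ P.m + P.K := hkK.trans (Nat.le_add_left _ _)
  have hη : 0 < P.eta k := eta_pos P k
  have hη1 : P.eta k ≤ 1 := eta_le_one P k
  have hηd : 0 ≤ P.eta k ^ P.d := (pow_pos hη _).le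
  have hN : 1 ≤ P.eta k * (P.sitesPerDir 0 : ℝ) := one_le_eta_mul_sitesPerDir P hkm
  have hT := torusConst_nonneg
  have hS : 0 ≤ ((1 + msq) + a * (16 * Real.exp (4 * δ) * 1 * (1 + radialConst 3 δ 1 0) + 4 * Real.exp (2 * δ) * 1)) * C_G := by
    have := radialConst_nonneg 3 hδ zero_le_one 0; positivity
  have hγ0 : 0 ≤ min δ (1 / 2) / 2 := by positivity
  have hγδ : 2 * (min δ (1 / 2) / 2) ≤ δ := by linarith [min_le_left δ (1 / 2)]
  have hγh : 2 * (min δ (1 / 2) / 2) ≤ 1 / 2 := by linarith [min_le_right δ (1 / 2)]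
  have hconv := conv22_le hPd hη hδ (by norm_num : (0 : ℝ) < 1 / 2) hγ0 hγδ hγh hS
    (by linarith : (0 : ℝ) ≤ 3037500 + torusConst + 472501)
    (fun y z' : Site P 0 => ∑ z : Site P 0, d1Kernel (P.eta k)⁻¹ μ' (G0xi P a msq k) y z * Dmid P a msq k z z')
    (fun z' x' : Site P 0 => d1Kernel (P.eta k)⁻¹ μ (CxiT (P.eta k)) x' z')
    (fun y z' => abs_d1G_Dmid_le hPd ha hmsq hk1 hkK hδ hCG hG2 μ' y z')
    (fun z' x' => by
      show |d1Kernel (P.eta k)⁻¹ μ (CxiT (P.eta k)) x' z'| ≤ _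
      rw [supDist_comm z' x']
      exact abs_d1Kernel_CxiT_profile hPd hη hη1 hN μ x' z') x x'
  rw [d2Kernel_Mxi ha hmsq hk1, abs_mul, abs_of_nonneg hηd]
  calc P.eta k ^ P.d * |∑ z' : Site P 0, (∑ z : Site P 0, d1Kernel (P.eta k)⁻¹ μ' (G0xi P a msq k) x z *
          Dmid P a msq k z z') * d1Kernel (P.eta k)⁻¹ μ (CxiT (P.eta k)) x' z'|
      ≤ P.eta k ^ P.d * ∑ z' : Site P 0, |(∑ z : Site P 0, d1Kernel (P.eta k)⁻¹ μ' (G0xi P a msq k) x z *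
          Dmid P a msq k z z') * d1Kernel (P.eta k)⁻¹ μ (CxiT (P.eta k)) x' z'| :=
        mul_le_mul_of_nonneg_left (Finset.abs_sum_le_sum_abs _ _) hηd
    _ = ∑ z' : Site P 0, P.eta k ^ P.d * (|∑ z : Site P 0, d1Kernel (P.eta k)⁻¹ μ' (G0xi P a msq k) x z *
          Dmid P a msq k z z'| * |d1Kernel (P.eta k)⁻¹ μ (CxiT (P.eta k)) x' z'|) := by
        rw [Finset.mul_sum]
        exact Finset.sum_congr rfl fun z' _ => by rw [abs_mul]
    _ ≤ _ := hconv
    _ = _ := by ring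

end Bounds

end

end Literature.MathematicalPhysics.QuantumFieldTheory.Balaban1983to89.B3MxiDifferenceProfiles
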